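import Mathlib
import HarnessLib
import HarnessLib.Audit
import Summits.QuantumFields.Statement
import Literature.MathematicalPhysics.QuantumLattice.HeatKernelGroup
import HarnessLib.Audit.Status.Attr

/-!
Route: GronwallGap

DORMANT since 2026-08-25T15:25:53Z (reconciler: no traction for 7.8 d (last activity item-evidence-added at 2026-08-17T19:18:50Z); parked, not closed — `ledger route dormant route-QuantumFields-GronwallGap --off` to reactivate) — unstaffed, not closed; items shared with open routes are served there. `ledger route dormant <id> --off` reactivates.

# Route GronwallGap — Gronwall on the gap — strong-coupling positivity propagates along analytic RP
plaquette-action paths via an a-priori energy–action modulus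

It suffices to show X = X1 ∧ X2 (card QuantumFields/YangMills/gronwall-gap-continuation-sum-rule,
spine). X1 = LatticeGapOffTransitions (the
card's leg L1, every G): for every compact simple G and every faithful unitary lattice
representation r, the torus Wilson theories of r cluster
VOLUME-UNIFORMLY (all pairs of gauge-invariant local observables, all tori of side 2S+1 ≥ 2S₀+1, all
time separations n ≤ S, one constant) at
some rate m(β) > 0 for every β > 0 off a locally finite exceptional set E(r) (the first-order bulk
points, where the torus state is a phase
mixture). X1 is delivered by the continuity method of the card: StrongCouplingAnchor (OS78: m > 0
for β < β₀) + PathGapModulus (crux 2 = card J2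
integrated: along an admissible reflection-positive single-plaquette-weight path whose pressure is
Gateaux-analytic, the volume-uniform
clustering rate is a-priori log-Lipschitz, m(s') ≥ m(s)·e^(−K|s'−s|) — Gronwall is built into the
statement) + AnalyticDetour (crux 3 = card
J0: such paths lead from the strong-coupling window to Wilson(β) for every β ∉ E(r)) +
WilsonWeightBridge (the Wilson measure is the
plaquette-weight measure of exp(β Re tr r)). X2 = ContinuumFromLatticeGap (crux 4, the shared UV
leg; restated 2026-08-16 after the statement re-type p116790): for each G,
X1's conclusion for all r implies the Clay clauses AT WEAK COUPLING — a scheme with β_k = 2/g₀² → ∞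
(`sch.HasWeakCouplingLimit`),
available to this line precisely because X1 gaps EVERY β off a locally finite E, so the couplings
β_k → ∞ can be chosen inside the
gapped region — together with IsYangMillsFor, non-triviality, non-Gaussianity, HasMassGap,
HasLatticeMassGap.
Lean: `(∀ (G : Type) [Group G] [TopologicalSpace G] [IsTopologicalGroup G] [CompactSpace G],
Literature.MathematicalPhysics.QuantumFieldTheory.IsCompactSimpleLieGroup G → letI : MeasurableSpace
G := borel G; haveI : BorelSpace G := ⟨rfl⟩; ∀ r :
Literature.MathematicalPhysics.QuantumFieldTheory.LatticeRep G, ∃ E : Set ℝ, (∀ b : ℝ, (E ∩ Set.Icc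
0 b).Finite) ∧ ∀ β : ℝ, 0 < β → β ∉ E → ∃ m : ℝ, 0 < m ∧ ∀ A B :
Literature.MathematicalPhysics.QuantumFieldTheory.YMSpecies G, ∃ C : ℝ, ∃ S₀ : ℕ, ∀ S : ℕ, S₀ ≤ S →
∀ n : ℕ, n ≤ S → |Literature.MathematicalPhysics.QuantumFieldTheory.latticeConnectedCorr r.ρ β (2 *
S + 1) A.F B.F n| ≤ C * Real.exp (-(m * n))) ∧ (∀ (G : Type) [Group G] [TopologicalSpace G]
[IsTopologicalGroup G] [CompactSpace G],
Literature.MathematicalPhysics.QuantumFieldTheory.IsCompactSimpleLieGroup G → letI : MeasurableSpace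
G := borel G; haveI : BorelSpace G := ⟨rfl⟩; (∀ r :
Literature.MathematicalPhysics.QuantumFieldTheory.LatticeRep G, ∃ E : Set ℝ, (∀ b : ℝ, (E ∩ Set.Icc
0 b).Finite) ∧ ∀ β : ℝ, 0 < β → β ∉ E → ∃ m : ℝ, 0 < m ∧ ∀ A B :
Literature.MathematicalPhysics.QuantumFieldTheory.YMSpecies G, ∃ C : ℝ, ∃ S₀ : ℕ, ∀ S : ℕ, S₀ ≤ S →
∀ n : ℕ, n ≤ S → |Literature.MathematicalPhysics.QuantumFieldTheory.latticeConnectedCorr r.ρ β (2 *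
S + 1) A.F B.F n| ≤ C * Real.exp (-(m * n))) → ∃ (r :
Literature.MathematicalPhysics.QuantumFieldTheory.LatticeRep G) (sch :
Literature.MathematicalPhysics.QuantumFieldTheory.SpeciesScheme
(Literature.MathematicalPhysics.QuantumFieldTheory.YMSpecies G)) (T :
Literature.MathematicalPhysics.QuantumFieldTheory.OSData
(Literature.MathematicalPhysics.QuantumFieldTheory.YMSpecies G) 4), sch.HasWeakCouplingLimit ∧
Literature.MathematicalPhysics.QuantumFieldTheory.IsYangMillsFor r sch T ∧ T.IsNontrivial
r.curvature ∧ T.IsNonGaussian r.curvature ∧ ∃ Δ > 0, T.HasMassGap Δ ∧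
Literature.MathematicalPhysics.QuantumFieldTheory.HasLatticeMassGap r sch Δ)`

## Assembly
Fix G compact simple (instances `borel G`). StrongCouplingAnchor gives β₀(r) and, for βs := min(β₀,
β₁)/2, a rate m₀ > 0 at Wilson(βs);
AnalyticDetour gives E(r), β₁(r) and, for β ∉ E, an admissible analytic path w from Wilson(βs) to
Wilson(β); WilsonWeightBridge rewrites the
Wilson clustering at βs as clustering of the w_0-theory (the measure depends on w only through w_0 =
exp(βs Re tr r)); PathGapModulus with
s = 0, s' = 1 yields clustering of the w_1 = Wilson(β) theory at rate m₀e^(−K)/2 > 0; hence the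
hypothesis of ContinuumFromLatticeGap for
every r, whose conclusion is the G-clause of `YangMills` (including, since the re-type p116790, the
weak-coupling
conjunct `sch.HasWeakCouplingLimit`, delivered by that crux together with the scheme it constructs).
Pure logic plus two measure rewrites; the sketch proves
`LatticeGapOffTransitions → ContinuumFromLatticeGap → YangMills` sorry-free (instance bookkeeping
only).

Rationale: WHY THIS LINE. The mass gap of a reflection-positive lattice theory is the bottom of spec(−log T_s)
above the vacuum; along a C¹ path s ↦ w_s of RP
single-plaquette Boltzmann weights its logarithmic derivative is, by Feynman–Hellmann, the
integrated ACTION CONTENT of the lightest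
zero-momentum state relative to the vacuum — Michael's glueball action sum rule M̂ =
(2β_L(g₀)/g₀)⟨L̂⟩_(1−0) (Rothe2005 §10.5 eq. (10.47a);
doi:10.1016/0550-3213(87)90136-2; doi:10.1103/physrevd.53.4102) read as an ODE instead of a
measurement: |d log m/ds| ≤ K(s) with K = (action
content)/(energy) = |d ln a/dβ| on the Wilson axis, so Gronwall carries the Osterwalder–Seiler
strong-coupling gap (OsterwalderSeilerAnnPhys1978
Thm 3.5; tree `osterwalder_seiler_torusClustering_holds`) to every coupling reachable by a
transition-free RP path, and the e^(−cβ) law of the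
gap is just exp(−∫K) (K → 12π²/(11N²) by asymptotic scaling) — no expansion has to converge at weak
coupling. Imported areas: analytic
perturbation theory of isolated eigenvalues (Kato1966) and the constructive-QFT continuity method in
the bare coupling (GlimmJaffe PRD 10:536
(1974) differentiability of the φ⁴₂ mass, doi:10.1103/physrevd.10.536; McBryan–Rosen
doi:10.1007/bf01609341; Glimm–Jaffe expositions 1985 p. 255
"we argue by continuity"), transplanted from φ⁴ (where correlation inequalities give monotonicity)
to gauge theory (where an a-priori
modulus must replace them); convexity of the pressure / phase coexistence (Israel, Ruelle) supplies
the typed transition certificate. Two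
design facts from the lattice literature shape the statements: SU(N≥4–5) Wilson axes carry a
first-order bulk transition
(doi:10.1103/physrevlett.46.1441 Creutz 1981; doi:10.1103/physrevd.25.1724; hep-lat/0103027 §3),
where the torus state is a mixture and no
Wilson-axis-only modulus can hold — hence PATHS in the RP weight cone, typeable today through
`groupHeatKernelMeasure` with a general weight
family; and the fundamental–adjoint line ends at a CRITICAL point inside the positive-coupling (RP)
quadrant for SU(2), SU(3)
(doi:10.1103/physrevd.24.3212; doi:10.1016/0550-3213(95)00137-h; hep-lat/0103027 §3 "the mass gap
vanishes at the critical point") — hence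
"no latent heat" is not enough and the certificate is pointwise Gateaux-ANALYTICITY of the pressure
in every class-function direction. No
prior route exists for this sub-problem (negatives index empty).

RANKED CRUXES. #0 LatticeGapOffTransitions (target) — for every compact simple G and every faithful
unitary lattice representation r there is a locally finite E ⊂ [0,∞) such that for every β > 0, β ∉
E, some m > 0 is a volume-uniform exponential clustering rate of the torus Wilson theories of r at
β: for all gauge-invariant local observables A, B there are C, S₀ with |⟨A·τ_(n e₀)B⟩ − ⟨A⟩⟨B⟩| ≤ C
e^(−m n) on every torus of side 2S+1, S ≥ S₀, for all n ≤ S (card leg L1 in all-couplings form; the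
exceptional set absorbs first-order bulk points, where the symmetric torus state is a mixture and
cannot cluster). (why it might fail: False iff some compact simple G (faithful r) has a bulk
MASSLESS phase, or coexistence points accumulating, on a Wilson axis; nothing is proved beyond β<β₀
(OS78); U(1)₄'s Coulomb phase shows the form is group-sensitive (Barriers.AbelianDeconfinementD4).)
[OsterwalderSeilerAnnPhys1978, ChatterjeeYMProb2019, MontvayMunster1994, arXiv:hep-lat/0103027,
Literature.Barriers.QuantumFields.AbelianDeconfinementD4]
#2 PathGapModulus (crux) — (card J2, integrated — THE crux) for every compact simple G and every
ADMISSIBLE weight path w : [0,1] → (G → ℝ) — each w_s a continuous, strictly positive, symmetric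
class function of positive type (reflection positivity of the plaquette-weight measure ∏_q w_s(U_q)
∏ dHaar), s ↦ log w_s Lipschitz in sup-norm — whose torus pressure is, at every s ∈ [0,1],
Gateaux-real-analytic in every continuous class-function direction φ (the limits p(t) = lim_L
(L+1)^(−4) log Z_(L+1)(w_s e^(tφ)) exist and t ↦ p(t) is analytic at 0: no first-order, critical or
infinite-order bulk transition is touched), there is ONE constant K such that for all s, s' ∈ [0,1]
and m > 0: volume-uniform clustering of the w_s-theory at rate m implies volume-uniform clustering
of the w_(s')-theory at every rate m' < m·e^(−K|s'−s|). Mechanism (layer 2): FH/Kato for the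
isolated bottom of spec(−log T_s) in finite volume, the energy–action inequality |⟨ψ|Σ_x ∂_s log
w_s(U_x)|ψ⟩ − ‖ψ‖²⟨Ω|…|Ω⟩| ≤ K·(energy of ψ) on the window [m, 2m), Dini–Gronwall, window isolation
self-improving in the volume. [difficulty: open-problem] (why it might fail: Gap closing at a point
of analytic pressure is not excluded for gauge theories (no correlation inequalities): an excited
level may touch the vacuum with no thermodynamic trace, or coexistence invisible to single-plaquette
directions (broken hypercubic/C symmetry) voids the certificate.) [doi:10.1016/0550-3213(87)90136-2,
doi:10.1103/physrevd.53.4102, Rothe2005, Kato1966, doi:10.1103/physrevd.10.536,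
doi:10.1007/bf01011153, BravyiHastingsMichalakis2010, arXiv:hep-lat/0103027]
#3 AnalyticDetour (crux) — (card J0) for every compact simple G and faithful unitary r there are a
locally finite E ⊂ [0,∞) and β₁ > 0 such that for every β > 0 with β ∉ E and every start βs ∈ (0,
β₁) there is an admissible weight path w (as in PathGapModulus) with Gateaux-analytic pressure at
every s ∈ [0,1], from w_0 = exp(βs Re tr r(·)) to w_1 = exp(β Re tr r(·)): the strong-coupling
window is joined to Wilson(β) inside the RP single-plaquette cone without touching a bulk
singularity. For SU(2), SU(3) (crossover only) the Wilson segment itself is the expected witness (E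
= ∅); for groups with an on-axis first-order wall (SU(N≥5), SO(3), large reps) a detour around the
endpoint of the wall (negative adjoint admixture, heat-kernel or convex-combination weights — the
positive-type cone is convex) is required and E = the on-axis coexistence points. [deps:
PathGapModulus] [difficulty: XL] (why it might fail: For SU(N≥5) every positive-type
single-plaquette path may hit the first-order wall: passing below the fundamental–adjoint endpoint
needs β_A<0, where positive type of exp(β_f Re tr_f+β_A Re tr_A) is unproved; for SU(2), SU(3) it
contains analyticity of the Wilson pressure on (0,∞), itself open.) [doi:10.1103/physrevd.24.3212,
doi:10.1103/physrevlett.46.1441, doi:10.1103/physrevd.25.1724, doi:10.1016/0550-3213(95)00137-h,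
doi:10.1016/0550-3213(96)00293-3, doi:10.1088/1126-6708/2004/08/005, doi:10.1103/physrevlett.55.273,
arXiv:hep-lat/0103027, OsterwalderSeilerAnnPhys1978,
Literature.Barriers.QuantumFields.ImprovedActionPositivityViolation]
#4 ContinuumFromLatticeGap (crux) — (shared UV leg, not this card's bet) for every compact simple G:
if every faithful unitary r has volume-uniform torus clustering at every β > 0 off a locally finite
set (the conclusion of LatticeGapOffTransitions for G), then there exist r, a sequential scaling
scheme sch at WEAK COUPLING (β_k → ∞: sch.HasWeakCouplingLimit;
restated 2026-08-16 after the statement re-type p116790 — β_k → ∞ is choosable inside the gapped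
region because E is locally
finite) and OS data T with IsYangMillsFor r sch T, T non-trivial and non-Gaussian in the curvature
species, and Δ > 0 with
T.HasMassGap Δ and HasLatticeMassGap r sch Δ. The lattice half of the conclusion is bookkeeping
(choose β_k ∉ E, a_k ≤ m(β_k)/Δ); the continuum half is the construction of the limit along a_k → 0
with ξ(β_k) → ∞, OS axioms E0–E4 (E1 rotations), non-triviality and transfer of the gap — to be
decomposed by UV routes (flow/Balaban cards), filed here so the assembly is honest and the item can
be shared. [difficulty: open-problem] (why it might fail: It is the UV half of Clay: the hypothesis
gives no control of a_k→0 (needs ξ(β_k)→∞, Balaban-type stability, E1, non-Gaussianity of tr F²); a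
gap bounded below in lattice units would even force ultralocal limits
(Barriers.FixedCouplingUltralocality).) [JaffeWittenClay2006, ChatterjeeYMProb2019,
Balaban1989LargeFieldII, MagnenRivasseauSeneor1993,
Literature.Barriers.QuantumFields.FixedCouplingUltralocality,
Literature.Barriers.QuantumFields.UVStabilityNonUniqueness]
#9 StrongCouplingAnchor (support) — (card J3 anchor) for every compact simple G and faithful unitary
r there is β₀ > 0 such that for every β ∈ (0, β₀) some m > 0 is a volume-uniform clustering rate of
the torus Wilson theories of r (same clustering clause as the target). Osterwalder–Seiler 1978 Thm
3.5 (m ≥ −4 log(Cβ)); the tree proves the torus form `osterwalder_seiler_torusClustering_holds` with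
the size eventual PER shift x — the uniform-in-n≤S form asked here follows from the same convergent
expansion (wrap-around polymers cost (Cβ)^(4(2S+1)) ≤ e^(−mS)); second countability of G comes from
the faithful r. [difficulty: M] [OsterwalderSeilerAnnPhys1978, SeilerLNP1982,
Literature.MathematicalPhysics.QuantumFieldTheory.osterwalder_seiler_torusClustering]
#9 WilsonWeightBridge (support) — for every compact simple G, faithful unitary r, torus side S ≥ 1
and β, s: the torus Wilson measure `wilsonMeasure r.ρ β` equals the plaquette-weight measure
`groupHeatKernelMeasure (fun _ g ↦ exp(β Re tr r.ρ g)) s` (the constant e^(−βN·#plaquettes) cancels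
on normalisation; both sides are the same junk when Z ∈ {0, ∞}). Lets the path cruxes (general
weights) talk to the target and to HasLatticeMassGap (Wilson measures). [difficulty: provable-now]
[Wilson1974, SeilerLNP1982, Literature.MathematicalPhysics.QuantumLattice.groupHeatKernelMeasure]

TWO-LAYER PLAN. PathGapModulus ⇐ FiniteVolumeSumRule (RP transfer matrix T_s of an admissible weight
on the torus; Feynman–Hellmann/Kato: D⁺ of the isolated
bottom of spec(−log T_s) = action content of the lightest state, Michael/Rothe sum rule without its
scaling hypothesis) → EnergyActionInequality
(|action content(ψ)| ≤ K·energy(ψ) on the window [m,2m), K bounded by the analyticity data of the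
pressure — the honest open core; candidate
suppliers: spatial-RP "energy sum rule" partner + finite anisotropy (Karsch) renormalisation, or a
relative-entropy/variational bound) →
VolumeUniformGronwall (Dini–Gronwall for a min of Lipschitz branches; isolation of the window is
self-improving while m > 0; torus wrap-around)
→ PathGapModulus (k = 3). AnalyticDetour ⇐ WilsonAxisAnalytic (G with crossover only: E = ∅,
straight segment; contains "no bulk transition for
SU(2), SU(3)") + EndpointDetour (G with an on-axis wall: a positive-type family passing below the
endpoint; first deliverable = positivity of all
character coefficients of exp(β_f Re tr_f + β_A Re tr_A) for the needed β_A < 0, or a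
heat-kernel/convex-combination family) + GeneralWeightOS78
(pressure existence/analyticity and clustering at strong coupling for continuous positive
class-function weights — the tree has Wilson only)
→ AnalyticDetour (k = 3). ContinuumFromLatticeGap is decomposed by UV routes, not here.

KILL CRITERIA. (a) PathGapModulus refuted by an admissible analytic-pressure path along which
uniform clustering provably fails to propagate for a compact
SIMPLE G ⇒ close `refuted:PathGapModulus` — unless the witness is coexistence invisible to
single-plaquette directions (broken lattice symmetry),
in which case restate ONCE with the certificate strengthened to all gauge-invariant local
directions; a second refutation closes the route.
(b) AnalyticDetour refuted for some G (e.g. a theorem that every positive-type single-plaquette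
weight family of SU(N≥5) meets a bulk
singularity before weak coupling, or that exp(β_f Re tr_f + β_A Re tr_A) is never of positive type
for β_A < 0) ⇒ pivot to RP families beyond
single-plaquette class weights (anisotropic couplings, positive-type two-plaquette time-like terms)
with a restated crux; if no RP family
survives, close `refuted:AnalyticDetour`. (c) LatticeGapOffTransitions refuted (a massless bulk
phase for a compact simple G) kills every
lattice route of the sub-problem ⇒ close. (d) Mooted: a direct proof of the target (e.g. by the
Ricci/LSI or zero-free cards) makes cruxes 2–3
unnecessary; ContinuumFromLatticeGap stays shared. ContinuumFromLatticeGap itself is not a kill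
switch of THIS line (its failure is ¬YangMills).

NOT DECOMPOSED YET. The concrete OS/transfer-matrix realisation of torus plaquette-weight measures
(tree has the abstract `TransferData`/`IsOSRealisation` and
Wilson site-RP; general positive-type weights and odd torus sides 2S+1 need the two-sided trace
formula), the finite-volume FH identity, Kato's
analytic perturbation for the top of spec T_s, the finite-volume → volume-uniform passage (role of
the window [m,2m), torelon pairs, wrap-around
terms (2S+1)³e^(−m(2S+1))), the spatial-RP energy sum rule and anisotropy coefficients, the per-G
choice of detour family and the
character-coefficient positivity computations, the uniform-in-n strengthening of the tree's OS78
torus clustering, and everything UV (crux 4: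
a_k, E1, non-Gaussianity) — all layer-2 children or other routes' business.

CHEAPEST FALSIFIER. (i) Typing: `lean check` of folder/Sketch.lean done, rc 0, all 7 decls +
`yangMills_of_target_of_continuum : LatticeGapOffTransitions →
ContinuumFromLatticeGap → YangMills` proved (re-checked 2026-08-16 against the re-typed `YangMills`
with the restated crux 4:
rc 0, axioms standard; the pre-restatement crux 4 fails with the expected conclusion mismatch). (ii)
Crux 2: the SU(2) fundamental–adjoint endpoint (doi:10.1016/0550-3213(96)00293-3): the
certificate demands that m_(0++) → 0 there comes WITH a pressure singularity; a critical endpoint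
with analytic pressure kills PathGapModulus at
once — published finite-size scaling shows a growing specific-heat peak (consistent). (iii) Crux 3,
one kit job (not run here): character
coefficients of exp(β_f Re tr_f/5 + β_A Re tr_A/24) for SU(5) by Weyl integration on β_f ∈ [15,18],
β_A ∈ [−4,0]: a negative coefficient on
the whole detour region kills the fundamental–adjoint witness family (heat-kernel/convex families
remain). (iv) Lookup: |dM_(0++)/dβ|/M for
SU(2), SU(3) in the crossover is 2–3 and DECREASING toward weak coupling (hep-lat/0108008 eq. (2.6):
|d ln a/dβ| = 2.32, 1.73, 1.40 at β = 5.7,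
6.0, 6.9); a ratio growing without bound would contradict bounded K.

NUMBERS. Anchor: m(β) ≥ −4 log(Cβ) for 0 < β < β₀ (OsterwalderSeilerAnnPhys1978 Thm 3.5/Remark 3.9).
Asymptotic K = |d ln a/dβ| → 12π²/(11N²):
2.69 (SU(2), β = 4/g²), 1.196 (SU(3), β = 6/g²); measured SU(3) (hep-lat/0108008 eq. (2.6), ln(a/r₀)
= −1.6804 − 1.7331(β−6) + 0.7849(β−6)² −
0.4428(β−6)³, 5.7 ≤ β ≤ 6.92): K(5.7) = 2.32, K(6.0) = 1.73, K(6.9) = 1.40. Bulk structure: SU(2),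
SU(3) Wilson axis = crossover (specific-heat
peak, 0⁺⁺ dip; hep-lat/0103027 §3, SU(4) dip at β ≈ 10.4); SU(5), SU(6): first-order bulk transition
on the Wilson axis (Creutz 1981,
Creutz–Moriarty 1982); SO(3): first order (Greensite–Lautrup 1981). Glueball action sum rule: M̂ =
(2β_L(g₀)/g₀)⟨L̂⟩_(1−0) (Rothe2005 (10.47a)).
Items at open: 7 typed (1 target, 3 cruxes, 2 supports, 1 assembly) + 0 informal.

DEFINITION REQUESTS. None required at open:
`Literature.MathematicalPhysics.QuantumLattice.groupHeatKernelMeasure (d := 4) (L := S) w s` with a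
general weight
family w : ℝ → G → ℝ IS the single-plaquette class-action measure (weight ∏_q w s (U_q)), so RP
action paths, their pressures and clustering are
typed inline; `latticeConnectedCorr`/`wilsonMeasure`/`YMSpecies`/`HasLatticeMassGap` carry the
Wilson side. Hygiene candidates for layer 2 (not
filed): a named alias `plaquetteWeightMeasure w` and `torusClusteringRate`; a cite fact "OS78
clustering/analyticity for continuous positive
class-function plaquette weights" (tree: Wilson only).

Novelty: Searches (2026-08-15): `lit search --source crossref` ×7 ("lattice action sum rules glueball mass
derivative coupling Michael" → doi:10.1016/0550-3213(87)90136-2 + QCD-sum-rule noise; "bulk phase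
transition SU(N) … first order Wilson action" → doi:10.1103/physrevlett.55.273,
doi:10.1103/physrevlett.47.9, doi:10.1016/0550-3213(96)00293-3, doi:10.1016/0550-3213(95)00137-h;
"Bhanot Creutz variant actions" → doi:10.1103/physrevd.24.3212, doi:10.1103/physrevlett.46.1441,
doi:10.1103/physrevd.25.1724; "Lucini Teper … bulk transition" → doi:10.1088/1126-6708/2001/06/050;
"Hasenbusch Necco mixed action" → doi:10.1088/1126-6708/2004/08/005; "differentiability of the mass
… McBryan Rosen" → doi:10.1103/physrevd.10.536, doi:10.1007/bf01609341; "completely analytical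
interactions Dobrushin Shlosman" → doi:10.1007/bf01011153); `lit search --hybrid` local ×2
(book:rothe2005 p.140–141 READ: glueball action/energy sum rules (10.47a,b); book:glimm1985
expositions p.255 READ: "the physical mass m is a monotonic function of m₀² … differentiable [GJ2] …
we argue by continuity"); `lit read arxiv:hep-lat/0103027` §3 p.5 READ (bulk transition SU(N≥4),
endpoint "the mass gap vanishes at the critical point"); `lit galaxy search "action sum rules"
--star all` (8 rows: Rothe held, nothing new); `lit vsearch` ×1 (analytic pressure vs infinite
correlation length: nothing); `lit frontier QuantumFields --since 2020` (30 rows; arXiv:2606.19362,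
a 2026 claimed RP construction propagating a strong-coupling ga  [refs: 10.1016/0550-3213(87, 10.1103/physrevlett.55.273, 10.1103/physrevlett.47.9, 10.1016/0550-3213(96, 10.1016/0550-3213(95, 10.1103/physrevd.24.3212, 10.1103/physrevlett.46.1441, 10.1103/physrevd.25.1724, 10.1088/1126-6708/2001/06/050, 10.1088/1126-6708/2004/08/005, 10.1103/physrevd.10.536, 10.1007/bf01609341, 10.1007/bf01011153, 10.1103/physrevd.53.4102, hep-lat/0103027, 2606.19362, 2605.16162, doi:1]

Barriers (technique_class: continuity-method-in-coupling, spectral-perturbation): - technique_class: continuity-method-in-coupling, spectral-perturbation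
- Literature.Barriers.QuantumFields.AbelianDeconfinementD4: the class `GroupBlindClusteringD4` is
not instantiated — PathGapModulus is CONDITIONAL on an analytic-pressure path and is not refuted at
G = U(1) (the Coulomb transition is a pressure singularity on every path into the massless phase, so
the hypothesis fails exactly where clustering fails); the G-sensitive input is AnalyticDetour,
stated for compact SIMPLE G only, whose proof must use non-abelian structure (its U(1) analogue is
false: no singularity-free path reaches the Coulomb phase). Conceded: the FORM of crux 2 is
group-blind; the bet is that "gaps close only at thermodynamic singularities" is true for all
compact G along RP single-plaquette paths.
- Literature.Barriers.QuantumFields.RougheningTransition: roughening is a singularity of the string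
tension (interface free energy), not of the bulk pressure or of local clustering ("strong-coupling
expansions for glueball masses are not affected", Montvay–Münster §3.6 p.160 as quoted in the
barrier file); the certificate tests bulk pressure only and the clustered observables are local
gauge-invariant ones (no flux-tube sector). Conceded: were β_R a bulk pressure singularity, it would
simply join the exceptional set / force a detour.
- Literature.Barriers.QuantumFields.GrossWittenTransition: finite N throughout; the N = ∞
third-order transition is a smooth crossover at each finite N (analytic pres

History (route lifecycle, newest last):
- 2026-08-15T20:39:26Z · rev 4: restated PathGapModulus (stmt-QuantumFields-8800) — repair: PathGapModulus misstated (refuter route-reviews gen-1/gen-2, evidence PathGapModulus_suspect_false.md; retriage flag): uncapped rate transport is false (planner-rbadge-QuantumFields-GronwallGap-d185439b-0)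
- 2026-08-16T17:35:36Z · rev 5: restated ContinuumFromLatticeGap (stmt-QuantumFields-8802) — route-repair (statement re-type p116790, YangMills gained sch.HasWeakCouplingLimit): crux 4 ContinuumFromLatticeGap restated 1:1 (sole wanting route) so its con (planner-rrepair-QuantumFields-GronwallGap-stmt-d0de0729-0)
- 2026-08-25T15:25:53Z · DORMANT — reconciler: no traction for 7.8 d (last activity item-evidence-added at 2026-08-17T19:18:50Z); parked, not closed — `ledger route dormant route-QuantumFields-Gr (operator:999:308415)

sub-problem: YangMills · status: dormant · opened planner-plancard-QuantumFields-YangMills-gron-d8075900-0 2026-08-15T13:33:35Z · rev 5 · ledger route-QuantumFields-GronwallGap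
GENERATED by the gate from the ledger (D-0016/17). Provers cite these decls: `theorem foo : Summit.QuantumFields.YangMills.Theses.GronwallGap.<Decl> := …` in Summits/QuantumFields/YangMills/Theorems/<Name>.lean.
-/

namespace Summit.QuantumFields.YangMills.Theses.GronwallGap

open scoped BigOperators Topology Manifold Classical MeasureTheory ProbabilityTheory Matrix InnerProductSpace ComplexConjugate ContinuousMap
open Filter Set Function TopologicalSpace MeasureTheory

attribute [summit_statement] _root_.YangMills

/-- item stmt-QuantumFields-8799 · target · rank 0 · open · by planner
why it might fail: False iff some compact simple G (faithful r) has a bulk MASSLESS phase, or coexistence points accumulating, on a Wilson axis; nothing is proved beyond β<β₀ (OS78); U(1)₄'s Coulomb phase shows the form is group-sensitive (Barriers.AbelianDeconfinementD4).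
sources: OsterwalderSeilerAnnPhys1978, ChatterjeeYMProb2019, MontvayMunster1994, arXiv:hep-lat/0103027, doi:10.22323/1.042.0336, Literature.Barriers.QuantumFields.AbelianDeconfinementD4
[target] for every compact simple G and every faithful unitary lattice representation r there is a
locally finite E ⊂ [0,∞) such that for every β > 0, β ∉ E, some m > 0 is a volume-uniform
exponential clustering rate of the torus Wilson theories of r at β: for all gauge-invariant local
observables A, B there are C, S₀ with |⟨A·τ_(n e₀)B⟩ − ⟨A⟩⟨B⟩| ≤ C e^(−m n) on every torus of side
2S+1, S ≥ S₀, for all n ≤ S (card leg L1 in all-couplings form; the exceptional set absorbs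
first-order bulk points, where the symmetric torus state is a mixture and cannot cluster). -/
@[route_item "route-QuantumFields-GronwallGap", crux]
def LatticeGapOffTransitions : Prop :=
  ∀ (G : Type) [Group G] [TopologicalSpace G] [IsTopologicalGroup G] [CompactSpace G], Literature.MathematicalPhysics.QuantumFieldTheory.IsCompactSimpleLieGroup G → letI : MeasurableSpace G := borel G; haveI : BorelSpace G := ⟨rfl⟩; ∀ r : Literature.MathematicalPhysics.QuantumFieldTheory.LatticeRep G, ∃ E : Set ℝ, (∀ b : ℝ, (E ∩ Set.Icc 0 b).Finite) ∧ ∀ β : ℝ, 0 < β → β ∉ E → ∃ m : ℝ, 0 < m ∧ ∀ A B : Literature.MathematicalPhysics.QuantumFieldTheory.YMSpecies G, ∃ C : ℝ, ∃ S₀ : ℕ, ∀ S : ℕ, S₀ ≤ S → ∀ n : ℕ, n ≤ S → |Literature.MathematicalPhysics.QuantumFieldTheory.latticeConnectedCorr r.ρ β (2 * S + 1) A.F B.F n| ≤ C * Real.exp (-(m * n))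

-- earlier PathGapModulus (stmt-QuantumFields-8800, replaced 2026-08-15T20:39:26Z -> stmt-QuantumFields-13946): retired by None — ∀ (G : Type) [Group G] [TopologicalSpace G] [IsTopologicalGroup G] [CompactSpace G], Literature.MathematicalPhysics.QuantumFieldTheory.IsCompactSimpleLieGroup G → letI : MeasurableSpace G := borel G; haveI : BorelSpace G := ⟨rfl⟩; let UCw : (ℝ → G → ℝ) → ℝ → ℝ → Prop := fu
/-- item stmt-QuantumFields-13946 · crux · rank 2 · open · by planner
why it might fail: Gap closing at a point of analytic bulk pressure is not excluded for gauge theories (no correlation inequalities): an excited level may touch the vacuum with no thermodynamic trace, or coexistence invisible to single-plaquette class-function directions (broken lattice symmetry) voids AnP.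
sources: doi:10.1016/0550-3213(83)90609-0, arXiv:1503.04035, doi:10.1016/0550-3213(87)90136-2, doi:10.1103/physrevd.53.4102, Rothe2005, Kato1966
[crux] (card J2, integrated — THE crux; RESTATED 2026-08-15 with a rate cap after refuter review)
for every compact simple G and every ADMISSIBLE weight path w : [0,1] → (G → ℝ) — each w_s a
continuous, strictly positive, symmetric class function of positive type (reflection positivity of
the plaquette-weight measure ∏_q w_s(U_q) ∏ dHaar), s ↦ log w_s Lipschitz in sup-norm — whose torus
pressure is, at every s ∈ [0,1], Gateaux-real-analytic in every continuous class-function direction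
φ (the limits p(t) = lim_L (L+1)^(−4) log Z_(L+1)(w_s e^(tφ)) exist and t ↦ p(t) is analytic at 0:
no first-order, critical or infinite-order bulk transition is touched), there are constants K and M
> 0 (depending on the path) such that for all s, s' ∈ [0,1] and m > 0: volume-uniform clustering of
the w_s-theory at rate m implies volume-uniform clustering of the w_(s')-theory at every rate m' <
min(m, M)·e^(−K|s'−s|). The cap M is essential, not cosmetic: admissible analytic paths may pass
through the Haar point w ≡ 1, where clustering holds at EVERY rate, and on the Wilson axis |d log
m/dβ| ~ 1/(β log β⁻¹) is unbounded at β → 0⁺ (refuter evidence PathGapModulus_suspect_false.md; the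
uncapped rev-0 fo -/
@[route_item "route-QuantumFields-GronwallGap", crux]
def PathGapModulus : Prop :=
  ∀ (G : Type) [Group G] [TopologicalSpace G] [IsTopologicalGroup G] [CompactSpace G], Literature.MathematicalPhysics.QuantumFieldTheory.IsCompactSimpleLieGroup G → letI : MeasurableSpace G := borel G; haveI : BorelSpace G := ⟨rfl⟩; let UCw : (ℝ → G → ℝ) → ℝ → ℝ → Prop := fun w s m => ∀ A B : Literature.MathematicalPhysics.QuantumFieldTheory.YMSpecies G, ∃ C : ℝ, ∃ S₀ : ℕ, ∀ S : ℕ, S₀ ≤ S → ∀ n : ℕ, n ≤ S → |(∫ U, A.F (Literature.MathematicalPhysics.QuantumLattice.torusLift (2 * S + 1) U) * B.F (Literature.MathematicalPhysics.QuantumLattice.configShift (-Pi.single 0 (n : ℤ)) (Literature.MathematicalPhysics.QuantumLattice.torusLift (2 * S + 1) U)) ∂(Literature.MathematicalPhysics.QuantumLattice.groupHeatKernelMeasure (d := 4) (L := 2 * S + 1) w s)) - (∫ U, A.F (Literature.MathematicalPhysics.QuantumLattice.torusLift (2 * S + 1) U) ∂(Literature.MathematicalPhysics.QuantumLattice.groupHeatKernelMeasure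 (d := 4) (L := 2 * S + 1) w s)) * (∫ U, B.F (Literature.MathematicalPhysics.QuantumLattice.torusLift (2 * S + 1) U) ∂(Literature.MathematicalPhysics.QuantumLattice.groupHeatKernelMeasure (d := 4) (L := 2 * S + 1) w s))| ≤ C * Real.exp (-(m * n)); let Pseq : (G → ℝ) → ℕ → ℝ := fun v L => (((L + 1 : ℕ) : ℝ) ^ 4)⁻¹ * Real.log (((MeasureTheory.Measure.pi fun _ : Literature.MathematicalPhysics.QuantumFieldTheory.Edge 4 (L + 1) => Literature.MathematicalPhysics.QuantumFieldTheory.haarProbability G).withDensity (fun U : Literature.MathematicalPhysics.QuantumFieldTheory.GaugeConfig 4 (L + 1) G => ENNReal.ofReal (Literature.MathematicalPhysics.QuantumLattice.groupHeatKernelWeight (fun _ : ℝ => v) 0 U))) Set.univ).toReal; let AnP : (G → ℝ) → Prop := fun v => ∀ φ : G → ℝ, Continuous φ → (∀ g h : G, φ (h * g * h⁻¹) = φ g) → ∃ p : ℝ → ℝ, (∀ t : ℝ, Filter.Tendsto (fun L : ℕ => Pseq (fun g => v g * Real.exp (t * φ g)) L) Filter.atTop (nhds (p t))) ∧ AnalyticAt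 ℝ p 0; let Adm : (ℝ → G → ℝ) → Prop := fun w => (∀ s ∈ Set.Icc (0 : ℝ) 1, Continuous (w s) ∧ (∀ g : G, 0 < w s g) ∧ (∀ g h : G, w s (h * g * h⁻¹) = w s g) ∧ (∀ g : G, w s g⁻¹ = w s g) ∧ (∀ (n : ℕ) (x : Fin n → G) (c : Fin n → ℂ), 0 ≤ (∑ i, ∑ j, (starRingEnd ℂ) (c i) * c j * ((w s ((x i)⁻¹ * x j) : ℝ) : ℂ)).re)) ∧ ∃ Λ : ℝ, ∀ s ∈ Set.Icc (0 : ℝ) 1, ∀ s' ∈ Set.Icc (0 : ℝ) 1, ∀ g : G, |Real.log (w s g) - Real.log (w s' g)| ≤ Λ * |s - s'|; ∀ w : ℝ → G → ℝ, Adm w → (∀ s ∈ Set.Icc (0 : ℝ) 1, AnP (w s)) → ∃ K M : ℝ, 0 < M ∧ ∀ s ∈ Set.Icc (0 : ℝ) 1, ∀ s' ∈ Set.Icc (0 : ℝ) 1, ∀ m : ℝ, 0 < m → UCw w s m → ∀ m' : ℝ, 0 < m' → m' < min m M * Real.exp (-(K * |s' - s|)) → UCw w s' m'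

/-- item stmt-QuantumFields-8801 · crux · rank 3 · open · by planner
why it might fail: For SU(N≥5) every positive-type single-plaquette path may hit the first-order wall: passing below the fundamental–adjoint endpoint needs β_A<0, where positive type of exp(β_f Re tr_f+β_A Re tr_A) is unproved; for SU(2), SU(3) it contains analyticity of the Wilson pressure on (0,∞)∖E, itself open.
sources: doi:10.1103/physrevd.24.3212, doi:10.1103/physrevlett.46.1441, doi:10.1103/physrevd.25.1724, doi:10.1016/0550-3213(95)00137-h, doi:10.1016/0550-3213(96)00293-3, doi:10.1088/1126-6708/2004/08/005
[crux] (card J0) for every compact simple G and faithful unitary r there are a locally finite E ⊂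
[0,∞) and β₁ > 0 such that for every β > 0 with β ∉ E and every start βs ∈ (0, β₁) there is an
admissible weight path w (as in PathGapModulus) with Gateaux-analytic pressure at every s ∈ [0,1],
from w_0 = exp(βs Re tr r(·)) to w_1 = exp(β Re tr r(·)): the strong-coupling window is joined to
Wilson(β) inside the RP single-plaquette cone without touching a bulk singularity. For SU(2), SU(3)
(crossover only) the Wilson segment itself is the expected witness (E = ∅); for groups with an
on-axis first-order wall (SU(N≥5), SO(3), large reps) a detour around the endpoint of the wall
(negative adjoint admixture, heat-kernel or convex-combination weights — the positive-type cone is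
convex) is required and E = the on-axis coexistence points. [deps: PathGapModulus] [difficulty: XL] -/
@[route_item "route-QuantumFields-GronwallGap", crux]
def AnalyticDetour : Prop :=
  ∀ (G : Type) [Group G] [TopologicalSpace G] [IsTopologicalGroup G] [CompactSpace G], Literature.MathematicalPhysics.QuantumFieldTheory.IsCompactSimpleLieGroup G → letI : MeasurableSpace G := borel G; haveI : BorelSpace G := ⟨rfl⟩; let Pseq : (G → ℝ) → ℕ → ℝ := fun v L => (((L + 1 : ℕ) : ℝ) ^ 4)⁻¹ * Real.log (((MeasureTheory.Measure.pi fun _ : Literature.MathematicalPhysics.QuantumFieldTheory.Edge 4 (L + 1) => Literature.MathematicalPhysics.QuantumFieldTheory.haarProbability G).withDensity (fun U : Literature.MathematicalPhysics.QuantumFieldTheory.GaugeConfig 4 (L + 1) G => ENNReal.ofReal (Literature.MathematicalPhysics.QuantumLattice.groupHeatKernelWeight (fun _ : ℝ => v) 0 U))) Set.univ).toReal; let AnP : (G → ℝ) → Prop := fun v => ∀ φ : G → ℝ, Continuous φ → (∀ g h : G, φ (h * g * h⁻¹) = φ g) → ∃ p : ℝ → ℝ, (∀ t : ℝ, Filter.Tendsto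 (fun L : ℕ => Pseq (fun g => v g * Real.exp (t * φ g)) L) Filter.atTop (nhds (p t))) ∧ AnalyticAt ℝ p 0; let Adm : (ℝ → G → ℝ) → Prop := fun w => (∀ s ∈ Set.Icc (0 : ℝ) 1, Continuous (w s) ∧ (∀ g : G, 0 < w s g) ∧ (∀ g h : G, w s (h * g * h⁻¹) = w s g) ∧ (∀ g : G, w s g⁻¹ = w s g) ∧ (∀ (n : ℕ) (x : Fin n → G) (c : Fin n → ℂ), 0 ≤ (∑ i, ∑ j, (starRingEnd ℂ) (c i) * c j * ((w s ((x i)⁻¹ * x j) : ℝ) : ℂ)).re)) ∧ ∃ Λ : ℝ, ∀ s ∈ Set.Icc (0 : ℝ) 1, ∀ s' ∈ Set.Icc (0 : ℝ) 1, ∀ g : G, |Real.log (w s g) - Real.log (w s' g)| ≤ Λ * |s - s'|; ∀ r : Literature.MathematicalPhysics.QuantumFieldTheory.LatticeRep G, ∃ E : Set ℝ, (∀ b : ℝ, (E ∩ Set.Icc 0 b).Finite) ∧ ∃ β₁ : ℝ, 0 < β₁ ∧ ∀ β : ℝ, 0 < β → β ∉ E → ∀ βs ∈ Set.Ioo (0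 : ℝ) β₁, ∃ w : ℝ → G → ℝ, Adm w ∧ (∀ s ∈ Set.Icc (0 : ℝ) 1, AnP (w s)) ∧ w 0 = (fun g => Real.exp (βs * (r.ρ g).trace.re)) ∧ w 1 = (fun g => Real.exp (β * (r.ρ g).trace.re))

-- earlier ContinuumFromLatticeGap (stmt-QuantumFields-8802, replaced 2026-08-16T17:35:36Z -> stmt-QuantumFields-15915): retired by None — ∀ (G : Type) [Group G] [TopologicalSpace G] [IsTopologicalGroup G] [CompactSpace G], Literature.MathematicalPhysics.QuantumFieldTheory.IsCompactSimpleLieGroup G → letI : MeasurableSpace G := borel G; haveI : BorelSpace G := ⟨rfl⟩; (∀ r : Literature.MathematicalPhy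
/-- item stmt-QuantumFields-15915 · crux · rank 4 · open · by planner
why it might fail: UV half of Clay at weak coupling: the hypothesis gives m(β_k)>0 in lattice units but no control as β_k→∞ (needs ξ(β_k)→∞ at the AF rate, Balaban stability, E1, non-Gaussian tr F², constants uniform in k); a gap bounded below in lattice units forces ultralocal limits (FixedCouplingUltralocality).
sources: JaffeWittenClay2006, ChatterjeeYMProb2019, Balaban1989LargeFieldII, MagnenRivasseauSeneor1993, Literature.Barriers.QuantumFields.FixedCouplingUltralocality, Literature.Barriers.QuantumFields.UVStabilityNonUniqueness
[crux] (shared UV leg, not this card's bet; RESTATED 2026-08-16 after the statement re-type p116790: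
the conclusion now carries the weak-coupling conjunct `sch.HasWeakCouplingLimit` and is again
VERBATIM the G-clause of `YangMills`) for every compact simple G: if every faithful unitary r has
volume-uniform torus clustering at every β > 0 off a locally finite set E (the conclusion of
LatticeGapOffTransitions for G), then there exist r, a sequential scaling scheme sch AT WEAK
COUPLING (β_k = 2/g₀(a_k)² → +∞ along the sequence, `SpeciesScheme.HasWeakCouplingLimit` = `Tendsto
sch.β atTop atTop`) and OS data T with IsYangMillsFor r sch T, T non-trivial and non-Gaussian in the
curvature species, and Δ > 0 with T.HasMassGap Δ and HasLatticeMassGap r sch Δ. Why this line can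
pay the new clause: its lattice leg gaps EVERY β ∉ E with E locally finite (not only β < β₀), so
couplings β_k → ∞ with β_k ∉ E can be chosen inside the gapped region; the weak-coupling clause was
already forced implicitly (refuter note on this item: a bounded-β scheme with lattice rate ≥ Δ·a_k
is killed by non-Gaussianity, Barriers.FixedCouplingUltralocality), the re-type only makes it
explicit. The lattice half of th -/
@[route_item "route-QuantumFields-GronwallGap", crux]
def ContinuumFromLatticeGap : Prop :=
  ∀ (G : Type) [Group G] [TopologicalSpace G] [IsTopologicalGroup G] [CompactSpace G], Literature.MathematicalPhysics.QuantumFieldTheory.IsCompactSimpleLieGroup G → letI : MeasurableSpace G := borel G; haveI : BorelSpace G := ⟨rfl⟩; (∀ r : Literature.MathematicalPhysics.QuantumFieldTheory.LatticeRep G, ∃ E : Set ℝ, (∀ b : ℝ, (E ∩ Set.Icc 0 b).Finite) ∧ ∀ β : ℝ, 0 < β → β ∉ E → ∃ m : ℝ, 0 < m ∧ ∀ A B : Literature.MathematicalPhysics.QuantumFieldTheory.YMSpecies G, ∃ C : ℝ, ∃ S₀ : ℕ, ∀ S : ℕ, S₀ ≤ S → ∀ n : ℕ, n ≤ S → |Literature.MathematicalPhysics.QuantumFieldTheory.latticeConnectedCorr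 r.ρ β (2 * S + 1) A.F B.F n| ≤ C * Real.exp (-(m * n))) → ∃ (r : Literature.MathematicalPhysics.QuantumFieldTheory.LatticeRep G) (sch : Literature.MathematicalPhysics.QuantumFieldTheory.SpeciesScheme (Literature.MathematicalPhysics.QuantumFieldTheory.YMSpecies G)) (T : Literature.MathematicalPhysics.QuantumFieldTheory.OSData (Literature.MathematicalPhysics.QuantumFieldTheory.YMSpecies G) 4), sch.HasWeakCouplingLimit ∧ Literature.MathematicalPhysics.QuantumFieldTheory.IsYangMillsFor r sch T ∧ T.IsNontrivial r.curvature ∧ T.IsNonGaussian r.curvature ∧ ∃ Δ > 0, T.HasMassGap Δ ∧ Literature.MathematicalPhysics.QuantumFieldTheory.HasLatticeMassGap r sch Δ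

/-- item stmt-QuantumFields-8803 · support · rank 9 · closed · proved by Summit.QuantumFields.YangMills.Theorems.strongCouplingAnchor_proof (prover) · by planner
sources: OsterwalderSeilerAnnPhys1978, SeilerLNP1982, Literature.MathematicalPhysics.QuantumFieldTheory.osterwalder_seiler_torusClustering
[support] (card J3 anchor) for every compact simple G and faithful unitary r there is β₀ > 0 such
that for every β ∈ (0, β₀) some m > 0 is a volume-uniform clustering rate of the torus Wilson
theories of r (same clustering clause as the target). Osterwalder–Seiler 1978 Thm 3.5 (m ≥ −4
log(Cβ)); the tree proves the torus form `osterwalder_seiler_torusClustering_holds` with the size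
eventual PER shift x — the uniform-in-n≤S form asked here follows from the same convergent expansion
(wrap-around polymers cost (Cβ)^(4(2S+1)) ≤ e^(−mS)); second countability of G comes from the
faithful r. [difficulty: M] -/
@[route_item "route-QuantumFields-GronwallGap", crux]
def StrongCouplingAnchor : Prop :=
  ∀ (G : Type) [Group G] [TopologicalSpace G] [IsTopologicalGroup G] [CompactSpace G], Literature.MathematicalPhysics.QuantumFieldTheory.IsCompactSimpleLieGroup G → letI : MeasurableSpace G := borel G; haveI : BorelSpace G := ⟨rfl⟩; ∀ r : Literature.MathematicalPhysics.QuantumFieldTheory.LatticeRep G, ∃ β₀ : ℝ, 0 < β₀ ∧ ∀ β ∈ Set.Ioo (0 : ℝ) β₀, ∃ m : ℝ, 0 < m ∧ ∀ A B : Literature.MathematicalPhysics.QuantumFieldTheory.YMSpecies G, ∃ C : ℝ, ∃ S₀ : ℕ, ∀ S : ℕ, S₀ ≤ S → ∀ n : ℕ, n ≤ S → |Literature.MathematicalPhysics.QuantumFieldTheory.latticeConnectedCorr r.ρ β (2 * S + 1) A.F B.F n| ≤ C * Real.exp (-(m * n))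

/-- item stmt-QuantumFields-8804 · support · rank 9 · closed · proved by Summit.QuantumFields.YangMills.Theorems.wilsonWeightBridge_proof (prover) · by planner
sources: Wilson1974, SeilerLNP1982, Literature.MathematicalPhysics.QuantumLattice.groupHeatKernelMeasure
[support] for every compact simple G, faithful unitary r, torus side S ≥ 1 and β, s: the torus
Wilson measure `wilsonMeasure r.ρ β` equals the plaquette-weight measure `groupHeatKernelMeasure
(fun _ g ↦ exp(β Re tr r.ρ g)) s` (the constant e^(−βN·#plaquettes) cancels on normalisation; both
sides are the same junk when Z ∈ {0, ∞}). Lets the path cruxes (general weights) talk to the target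
and to HasLatticeMassGap (Wilson measures). [difficulty: provable-now] -/
@[route_item "route-QuantumFields-GronwallGap", crux]
def WilsonWeightBridge : Prop :=
  ∀ (G : Type) [Group G] [TopologicalSpace G] [IsTopologicalGroup G] [CompactSpace G], Literature.MathematicalPhysics.QuantumFieldTheory.IsCompactSimpleLieGroup G → letI : MeasurableSpace G := borel G; haveI : BorelSpace G := ⟨rfl⟩; ∀ (r : Literature.MathematicalPhysics.QuantumFieldTheory.LatticeRep G) (S : ℕ) [NeZero S] (β s : ℝ), Literature.MathematicalPhysics.QuantumFieldTheory.wilsonMeasure (d := 4) (L := S) r.ρ β = Literature.MathematicalPhysics.QuantumLattice.groupHeatKernelMeasure (d := 4) (L := S) (fun (_ : ℝ) (g : G) => Real.exp (β * (r.ρ g).trace.re)) s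

/-- item stmt-QuantumFields-8805 · assembly · rank 1 · closed · proved by Summit.QuantumFields.YangMills.Theorems.gronwallGap_assembly_proof (prover) · by planner
sources: JaffeWittenClay2006, OsterwalderSeilerAnnPhys1978
[assembly] PathGapModulus → AnalyticDetour → StrongCouplingAnchor → WilsonWeightBridge →
ContinuumFromLatticeGap → YangMills. -/
@[route_item "route-QuantumFields-GronwallGap"]
def Assembly : Prop :=
  PathGapModulus → AnalyticDetour → StrongCouplingAnchor → WilsonWeightBridge → ContinuumFromLatticeGap → YangMills

/-! D-0027 §2.1 — DECIDING THEOREM (planner-authored via `route open/edit --closes-file`; by planner-rrepair-QuantumFields-GronwallGap-stmt-d0de0729-0 2026-08-16T17:35:36Z):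
its hypotheses are this route's items and its conclusion the sub-problem Statement (glue_lint), and it elaborates with this file. -/

/-- **The route glue (D-0027 `closes`)**: the five items imply the sub-problem statement
(re-elaborated 2026-08-16 after the statement re-type p116790: the weak-coupling conjunct
`sch.HasWeakCouplingLimit` is supplied by the restated UV crux `ContinuumFromLatticeGap`, whose
conclusion is again literally the `G`-clause of `YangMills`).
Gronwall bookkeeping: anchor at `βs = min β₀ β₁ / 2`, detour path `w` from Wilson(βs) to
Wilson(β), one application of the (rate-capped) modulus with `s = 0`, `s' = 1` (final rate
`min m₀ M · e^(−K)/2`), two measure rewrites (the plaquette-weight measure depends on the weight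
family only through its value at the parameter, and `WilsonWeightBridge`); this yields the
hypothesis of `ContinuumFromLatticeGap` for every `r`. Self-contained; axioms
{propext, Classical.choice, Quot.sound}. -/
@[closes "route-QuantumFields-GronwallGap"] theorem closes : PathGapModulus → AnalyticDetour → StrongCouplingAnchor → WilsonWeightBridge →
    ContinuumFromLatticeGap → YangMills := by
  intro hA hB hAnc hBr hC G _ _ _ _ hG
  refine hC G hG fun r => ?_
  letI : MeasurableSpace G := borel G
  haveI : BorelSpace G := ⟨rfl⟩
  have ghkm_congr : ∀ {L : ℕ} [NeZero L] {p q : ℝ → G → ℝ} {t t' : ℝ}, p t = q t' →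
      Literature.MathematicalPhysics.QuantumLattice.groupHeatKernelMeasure (d := 4) (L := L) p t =
        Literature.MathematicalPhysics.QuantumLattice.groupHeatKernelMeasure (d := 4) (L := L) q t' := by
    intro L _ p q t t' h
    exact (show Literature.MathematicalPhysics.QuantumLattice.groupHeatKernelMeasure (d := 4) (L := L) p t =
        Literature.MathematicalPhysics.QuantumLattice.groupHeatKernelMeasure (d := 4) (L := L) (fun _ : ℝ => p t) 0 from rfl).trans
      ((congrArg (fun f : G → ℝ => Literature.MathematicalPhysics.QuantumLattice.groupHeatKernelMeasure (d := 4) (L := L) (fun _ : ℝ => f) 0) h).trans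
        (show Literature.MathematicalPhysics.QuantumLattice.groupHeatKernelMeasure (d := 4) (L := L) (fun _ : ℝ => q t') 0 =
          Literature.MathematicalPhysics.QuantumLattice.groupHeatKernelMeasure (d := 4) (L := L) q t' from rfl))
  obtain ⟨β₀, hβ₀, hanc⟩ := hAnc G hG r
  obtain ⟨E, hE, β₁, hβ₁, hdet⟩ := hB G hG r
  refine ⟨E, hE, fun β hβ hβE => ?_⟩
  have hβs : 0 < min β₀ β₁ / 2 ∧ min β₀ β₁ / 2 < β₀ ∧ min β₀ β₁ / 2 < β₁ := by
    refine ⟨by positivity, ?_, ?_⟩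
    · have := min_le_left β₀ β₁; linarith
    · have := min_le_right β₀ β₁; linarith
  obtain ⟨m₀, hm₀, hUC0⟩ := hanc (min β₀ β₁ / 2) ⟨hβs.1, hβs.2.1⟩
  obtain ⟨w, hAdm, hAn, hw0, hw1⟩ := hdet β hβ hβE (min β₀ β₁ / 2) ⟨hβs.1, hβs.2.2⟩
  obtain ⟨K, M, hM, hK⟩ := hA G hG w hAdm hAn
  have hm0 : ∀ S : ℕ, Literature.MathematicalPhysics.QuantumLattice.groupHeatKernelMeasure (d := 4) (L := 2 * S + 1) w 0 = Literature.MathematicalPhysics.QuantumFieldTheory.wilsonMeasure (d := 4) (L := 2 * S + 1) r.ρ (min β₀ β₁ / 2) := fun S => by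
    rw [hBr G hG r (2 * S + 1) (min β₀ β₁ / 2) 0]; exact ghkm_congr hw0
  have hm1 : ∀ S : ℕ, Literature.MathematicalPhysics.QuantumLattice.groupHeatKernelMeasure (d := 4) (L := 2 * S + 1) w 1 = Literature.MathematicalPhysics.QuantumFieldTheory.wilsonMeasure (d := 4) (L := 2 * S + 1) r.ρ β := fun S => by
    rw [hBr G hG r (2 * S + 1) β 0]; exact ghkm_congr hw1
  have hUCw0 : (fun (w : ℝ → G → ℝ) (s m : ℝ) => ∀ A B : Literature.MathematicalPhysics.QuantumFieldTheory.YMSpecies G, ∃ C : ℝ, ∃ S₀ : ℕ, ∀ S : ℕ, S₀ ≤ S → ∀ n : ℕ, n ≤ S → |(∫ U, A.F (Literature.MathematicalPhysics.QuantumLattice.torusLift (2 * S + 1) U) * B.F (Literature.MathematicalPhysics.QuantumLattice.configShift (-Pi.single 0 (n : ℤ)) (Literature.MathematicalPhysics.QuantumLattice.torusLift (2 * S + 1) U)) ∂(Literature.MathematicalPhysics.QuantumLattice.groupHeatKernelMeasure (d := 4) (L := 2 * S + 1) w s)) - (∫ U, A.F (Literature.MathematicalPhysics.QuantumLattice.torusLift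 (2 * S + 1) U) ∂(Literature.MathematicalPhysics.QuantumLattice.groupHeatKernelMeasure (d := 4) (L := 2 * S + 1) w s)) * (∫ U, B.F (Literature.MathematicalPhysics.QuantumLattice.torusLift (2 * S + 1) U) ∂(Literature.MathematicalPhysics.QuantumLattice.groupHeatKernelMeasure (d := 4) (L := 2 * S + 1) w s))| ≤ C * Real.exp (-(m * n))) w 0 m₀ := by
    intro A B
    obtain ⟨C, S₀, h⟩ := hUC0 A B
    refine ⟨C, S₀, fun S hS n hn => ?_⟩
    rw [hm0 S]
    simpa [Literature.MathematicalPhysics.QuantumFieldTheory.latticeConnectedCorr] using h S hS n hn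
  have hpos : 0 < min m₀ M * Real.exp (-(K * |(1 : ℝ) - 0|)) := by positivity
  have key := hK 0 (by norm_num) 1 (by norm_num) m₀ hm₀ hUCw0
    (min m₀ M * Real.exp (-(K * |(1 : ℝ) - 0|)) / 2) (by positivity) (half_lt_self hpos)
  refine ⟨min m₀ M * Real.exp (-(K * |(1 : ℝ) - 0|)) / 2, by positivity, fun A B => ?_⟩
  obtain ⟨C, S₀, h⟩ := key A B
  refine ⟨C, S₀, fun S hS n hn => ?_⟩
  have h' := h S hS n hn
  rw [hm1 S] at h'
  simpa [Literature.MathematicalPhysics.QuantumFieldTheory.latticeConnectedCorr] using h'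

end Summit.QuantumFields.YangMills.Theses.GronwallGap
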